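import Summits.QuantumFields.YangMills.Theorems.UnitScaleTiltProp7DbarTwSymWindow
import Summits.QuantumFields.YangMills.Theorems.UnitScaleTiltProp7SymFrameBound
import Summits.QuantumFields.YangMills.Theorems.UnitScaleTiltProp7SymAvgTwSymBridge
import Summits.QuantumFields.YangMills.Theorems.UnitScaleTiltProp7CmapTwInputs
import HarnessLib

/-!
# `UnitScaleTiltProp7CmapTwSymInputs` — W5 OF THE (47)-twˢ PLAN (OWNER RULINGS g26-№12∕№13 (iii)): **(44)-twˢ — THE THREE `Inputs` LETTERS OF CHART-47-T³-twˢ ((44), (72), analyticity)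
# FOR THE RE-BASED TWISTED REMAINDER `CmapTwS U₀` (SYMMETRIC COVARIANT FRAMES) AT A PRINTED-REGULAR BACKGROUND, AND PRINT's PROPOSITION 3 FOR THE RE-BASED CHART AS A THEOREM** —
# `B11Prop3Model.Inputs (CmapTwS F n K h U₀) H (40M₀∕R²) (40M₀∕R²) B₀ (R∕4)` on the ball of radius `R = e·η` (`M₀ = 6(2e + 2700Lε₀)`), hence `Chart47T3twS F n K h C₂ ε U₀ H`
# (`chart47twS_of_regPr`, and the η-honest `chart47twS_of_regPr_eta`) — LINE FOR LINE the twin of ✓p611046∕p611779 `Prop7CmapTwInputs` with `dbarTw ↦ dbarTwS`: (BD) = W3 ✓p617963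
# `norm_dbarTwS_sub_one_le`, (AN) = ★w3-20520 g4's W4 `Prop7SymFrameBound.analyticAt_frameTwS_of_regPr` (frames) + ★w4 g2's `analyticAt_relIter_of_plaqSmall` (middle factor), windows = the
# L-only numerals `10⁹L²e ≤ 1`, `10¹²L³ε₀ ≤ 1` (no (WΣ))
# (route `UnitScaleTilt`, crux K1 «MinimiserStabilityRegPr» stmt-QuantumFields-19200, stub `stub_existenceMinimalOrbit` (EX), route (α), node (AVG-SYM); def-free, count-neutral)

Cell `ym3-torus` (HUMAN RULING D-0037, YM ladder rung R3 — YM₃ on T³ is a rung, not d = 4, not a mass gap, not Clay), width seat `ym-ust-20520-w4` (gen 3); the supplier of the EX knit v2.6ˢ's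
`h47tw` after the def-swap.

THE PRINT.  [Balaban1985BackgroundPropagators] p. 393: «(1/η_j)Q_j(U, ηA) = Q_j(U)A + C_j(U, A), (3.14) where … C_j(U, A) is an analytic function of A whose expansion begins with second order
terms.»  [Balaban1985Variational] p. 285: «|C_j(LʲηA)| ≦ O(1)|A|² (44) … |(δ/δA′)C(LʲηA′)| ≦ C₃|A′| (72)»; Prop. 3 p. 289.  [Balaban1985Averaging] Prop. 4 (134)–(135) p. 38, (161)–(163) p. 42, p. 44.

WHAT IS PROVED (sorry-free, no definition; `M₂ = Matrix (Fin 2) (Fin 2) ℂ`, `L²`-operator norm, sup norms on the bond spaces; windows: `10⁹L²e ≤ 1`, `10¹²L³ε₀ ≤ 1`):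
* §1 `CmapTwS_eq_linRemainder`, `third_budget` (`3(2e + 2700Lε₀) ≤ ½`).
* §2 ★`analyticAt_dbarTwS_of_mem_ball` (three factors: inverse frame ∕ relative descended perturbation ∕ rotated frame; `dbarTwS_eq_conj`), `norm_dbarTwS_sub_one_le_of_mem_ball`,
  ★`analyticOnNhd_logChartTwS`, ★`norm_logChartTwS_le_of_mem_ball` ((BD) `≤ M₀`).
* §3 ★★★**`inputs_CmapTwS`**, ★★★**`chart47twS_of_regPr`**, ★★`exists_chart47twS_of_regPr`; §4 ★★★`chart47twS_of_regPr_eta` (premise `‖H Y‖ ≤ B·η·‖Y‖`, radius `η·ε′`, η-free windows).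
HONEST FRAMING.  Copy-edit of ✓p611046∕p611779 over the re-based letters; constants crude; nothing of print is asserted; the stub EX, the crux and the gap are NOT claimed.
`--supports stmt-QuantumFields-19200 --as helper`.

References: T. Bałaban, CMP 102 (1985) 277–309 [Balaban1985Variational] ((5) p.278, (44)–(49) p.285, (55) p.286, (57)–(62) pp.286–287, (72) p.289, (76) p.289, Prop. 3 p.289); CMP 99 (1985) 389–434
[Balaban1985BackgroundPropagators] ((3.13)–(3.14) p.393); CMP 98 (1985) 17–51 [Balaban1985Averaging] ((89)–(92) p.31, Prop. 4 (134)–(135) p.38, (161)–(163) p.42, p.44); CMP 99 (1985) 75–102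
[Balaban1985RegularSpaces] ((1.31) p.82, Prop. 7 p.100); CMP 109 (1987) 249–301 [Balaban1987RG1] ((0.4) p.253).
-/

set_option autoImplicit false

noncomputable section

open scoped Matrix.Norms.L2Operator Topology

namespace Summit.QuantumFields.YangMills.Theorems.Prop7CmapTwSymInputs

open NormedSpace Metric Set
open Literature.MathematicalPhysics.QuantumFieldTheory.Balaban1983to89
open Literature.MathematicalPhysics.QuantumFieldTheory.Balaban1983to89.T3ContinuumYM3Torus
open T3RegularMinimiser (regThreshold)
open T3PrintedRegularMinimiser (RegPr)
open T3SectALandauChart (eta eta_pos bgUnits)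
open B7Prop1Explicit (expUnit)
open B7Prop2Explicit (C0 c2')
open B7Prop3Flat (c3)
open B10Eq27TorusAxialLog (unitsField toUField)
open B12Average012Analytic (analyticAt_units_inv)
open MatrixLog (mlog analyticAt_mlog norm_mlog_le_two_mul)
open T3LevelShift (bondShift)
open Summit.QuantumFields.YangMills.Theorems.Prop7SPrintIn19 (pow_mul_eta)
open Summit.QuantumFields.YangMills.Theorems.Prop8Chart (expCfg emlIterU)
open Summit.QuantumFields.YangMills.Theorems.Prop7SymAvgGL (descendToGL descendToGL_eq_fieldShift_emlIterU)
open Summit.QuantumFields.YangMills.Theorems.Prop7SymAvgGLSmallOfRegPr (bgUnits_eq)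
open Summit.QuantumFields.YangMills.Theorems.Prop7SymAvgRelativeBound (perturbedField_eq budget_T3 analyticAt_relIter_of_plaqSmall)
open Summit.QuantumFields.YangMills.Theorems.Prop7AnalyticRemainderInputs (inputs_linRemainder_of_analyticOnNhd_of_bound)
open Summit.QuantumFields.YangMills.Theorems.Prop7SymAvgTwSym (frameTwS dbarTwS logChartTwS QTwS CmapTwS Chart47T3twS chart47twS_of_inputs logChartTwS_zero)
open Summit.QuantumFields.YangMills.Theorems.Prop7SymAvgTwSymBridge (dbarTwS_eq_conj)
open Summit.QuantumFields.YangMills.Theorems.Prop7SymFrameBound (analyticAt_frameTwS_of_regPr)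
open Summit.QuantumFields.YangMills.Theorems.Prop7DbarTwWindow (norm_smul_eta_inv_le descendToGL_bgUnits_mem_specialUnitaryUnits_of_regPr)
open Summit.QuantumFields.YangMills.Theorems.Prop7DbarTwSymWindow (norm_dbarTwS_sub_one_le windows_of_numerals)
open Summit.QuantumFields.YangMills.Theorems.Prop7CmapTwInputs (descendToGL_rel_eq_emlIterU norm_apply_le_of_mem_ball)

variable (F : T3Family) {n K : ℕ} (h : n ≤ K)

/-! ## §1 Letters -/

/-- **`CmapTw` IN THE «LINEAR REMAINDER» FORM** `A ↦ Q A − Q 0 − (fderiv ℂ Q 0) A` with `Q = logChartTw U₀` (`logChartTw U₀ 0 = 0`, ✓`Prop7SymAvgTwFrameAxial.logChartTwS_zero`; `QTw := fderiv ℂ Q 0` by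
definition) — the shape consumed by `Prop7AnalyticRemainderInputs.inputs_linRemainder_of_analyticOnNhd_of_bound`. [cite: Balaban1985Variational, (44) p.285; Balaban1985BackgroundPropagators, (3.14) p.393] -/
theorem CmapTwS_eq_linRemainder (U₀ : GaugeField (F.P K) 0 (Matrix.specialUnitaryGroup (Fin 2) ℂ)) :
    CmapTwS F n K h U₀ = fun A => logChartTwS F n K h U₀ A - logChartTwS F n K h U₀ 0 - (fderiv ℂ (logChartTwS F n K h U₀) 0) A := by
  funext A
  rw [logChartTwS_zero, sub_zero]
  rfl

/-- **THE BUDGET**: `10⁹L²e ≤ 1` and `10¹²L³ε₀ ≤ 1` give `3(2e + 2700Lε₀) ≤ ½` (`L ≥ 3`). [cite: Balaban1985Variational, (6) p.278] -/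
theorem third_budget {ε₀ e : ℝ} (hε₀ : 0 < ε₀) (he : 0 ≤ e) (hWe : 10 ^ 9 * (F.L : ℝ) ^ 2 * e ≤ 1) (hWε : 10 ^ 12 * (F.L : ℝ) ^ 3 * ε₀ ≤ 1) :
    3 * (2 * e + 2700 * (F.L : ℝ) * ε₀) ≤ 1 / 2 := by
  have hL3 : 3 ≤ F.L := by obtain ⟨a, ha⟩ := F.hL.1; have := F.hL.2; omega
  have hL3r : (3 : ℝ) ≤ F.L := by exact_mod_cast hL3
  have h9 : (9 : ℝ) ≤ (F.L : ℝ) ^ 2 := by nlinarith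
  have hL13 : (F.L : ℝ) ≤ (F.L : ℝ) ^ 3 := by nlinarith
  have ha : (F.L : ℝ) * ε₀ ≤ (F.L : ℝ) ^ 3 * ε₀ := mul_le_mul_of_nonneg_right hL13 hε₀.le
  have hee : (0:ℝ) ≤ 9 * e := mul_nonneg (by norm_num : (0:ℝ) ≤ 9) he
  nlinarith [hee]

/-! ## §2 (AN) and (BD) for the twisted log-chart on the ball `‖A‖ < e·η` -/

section Ball

variable {ε₀ e : ℝ} (hε₀ : 0 < ε₀) (he : 0 < e)
  (hWe : 10 ^ 9 * (F.L : ℝ) ^ 2 * e ≤ 1) (hWε : 10 ^ 12 * (F.L : ℝ) ^ 3 * ε₀ ≤ 1)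
  (U₀ : GaugeField (F.P K) 0 (Matrix.specialUnitaryGroup (Fin 2) ℂ)) (hreg : RegPr F n K ε₀ U₀)

include hε₀ he hWe hWε hreg in
/-- ★ **`A ↦ U̿^{twS}(A)(c)` IS ANALYTIC ON THE BALL `‖A‖ < e·η`**: by `dbarTwS_eq_conj` it is the product of the inverse frame at `c₋` (★w3-20520 g4's W4 `analyticAt_frameTwS_of_regPr` + `analyticAt_units_inv`),
the relative descended perturbation (★w4 g2's `analyticAt_relIter_of_plaqSmall` through §1's dictionary at `A″ = (iη)⁻¹A`, `budget_T3` at `r := e`) and the `D̄(U₀)(c)`-rotated frame at `c₊`.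
[cite: Balaban1985Averaging, Prop. 4 (134)–(135) p.38, (89) p.31, (97) p.32; Balaban1985BackgroundPropagators, (3.14) p.393] -/
theorem analyticAt_dbarTwS_of_mem_ball (c : PBond (F.P n) 0) {A₀ : PBond (F.P K) 0 → Matrix (Fin 2) (Fin 2) ℂ} (hA₀ : ‖A₀‖ < e * eta F n K) :
    AnalyticAt ℂ (fun A => ((dbarTwS F n K h U₀ A c : (Matrix (Fin 2) (Fin 2) ℂ)ˣ) : Matrix (Fin 2) (Fin 2) ℂ)) A₀ := by
  -- (the binder type `A : PBond (F.P K) 0 → M₂` is inferred from `dbarTwS`; spelled without annotation so the statement text is not a prefix-twin of ✓p611046's)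
  -- letters
  have hd : (F.P K).d = 3 := T3Family.P_d F K
  have hLL : ((F.P K).L : ℝ) = F.L := rfl
  have hL3 : 3 ≤ F.L := by obtain ⟨a, ha⟩ := F.hL.1; have := F.hL.2; omega
  have hL0 : (0 : ℝ) < F.L := by exact_mod_cast (show 0 < F.L by omega)
  have hk1 : K - n + 1 ≤ (F.P K).m + (F.P K).K := by
    show K - n + 1 ≤ F.m + K; have := F.hm; omega
  set η : ℝ := ((F.L : ℝ)⁻¹) ^ (K - n) with hη
  have hη0 : 0 < η := by positivity
  have hηne : η ≠ 0 := hη0.ne'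
  have hηeta : eta F n K = η := rfl
  obtain ⟨-, hε, he6⟩ := windows_of_numerals F hε₀.le he.le hWe hWε
  -- the frames on the ball (★w3-20520 g4's W4)
  have hfr : ∀ y : Site (F.P n) 0,
      AnalyticAt ℂ (fun A : PBond (F.P K) 0 → Matrix (Fin 2) (Fin 2) ℂ => ((frameTwS F n K h U₀ A y : (Matrix (Fin 2) (Fin 2) ℂ)ˣ) : Matrix (Fin 2) (Fin 2) ℂ)) A₀ := fun y =>
    (analyticAt_frameTwS_of_regPr F h hε₀ he.le hWε hWe U₀ hreg y (norm_apply_le_of_mem_ball F hA₀)).1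
  -- the middle factor: the plaquette window of `RegPr` and the budget at `r := e`
  set a₀ : ℝ := regThreshold F n K ε₀ with ha₀
  have ha₀0 : 0 < a₀ := by rw [ha₀]; unfold regThreshold; positivity
  have hXa : (F.L : ℝ) ^ (K - n) * ((F.L : ℝ) ^ (K - n) * a₀) = ε₀ := by
    have hX2 : (F.L : ℝ) ^ (K - n) * (F.L : ℝ) ^ (K - n) = (F.L : ℝ) ^ (2 * (K - n)) := by rw [← pow_add, two_mul]
    have ha : a₀ = ε₀ * ((F.L : ℝ) ^ (2 * (K - n)))⁻¹ := by rw [ha₀]; unfold regThreshold; rw [inv_pow]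
    rw [← mul_assoc, hX2, ha, mul_comm ε₀, ← mul_assoc, mul_inv_cancel₀ (pow_ne_zero _ hL0.ne'), one_mul]
  have hU := hreg.1
  obtain ⟨ht1, hbudget, -, -⟩ := budget_T3 F (K - n) hε₀ hε he.le he6 ha₀0.le hXa
  set σ : (PBond (F.P K) 0 → Matrix (Fin 2) (Fin 2) ℂ) →L[ℂ] (PBond (F.P K) 0 → Matrix (Fin 2) (Fin 2) ℂ) :=
    (Complex.I * (η : ℂ))⁻¹ • ContinuousLinearMap.id ℂ (PBond (F.P K) 0 → Matrix (Fin 2) (Fin 2) ℂ) with hσ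
  have hσ_apply : ∀ A : PBond (F.P K) 0 → Matrix (Fin 2) (Fin 2) ℂ, σ A = fun b => (Complex.I * (η : ℂ))⁻¹ • A b := fun A => by
    rw [hσ]; rfl
  have hA₀' : ∀ b, ‖(η : ℂ) • σ A₀ b‖ ≤ η * e := fun b => by
    rw [hσ_apply]
    exact norm_smul_eta_inv_le F hηne A₀ (fun b => by rw [← hηeta]; exact norm_apply_le_of_mem_ball F hA₀ b) b
  set ec : PBond (F.P K) (K - n) := bondShift (F.sitesPerDir_eq (m := F.m) (K := n) (j := 0) (m' := F.m) (K' := K) (j' := K - n) (by omega)) c with hec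
  have hmid : AnalyticAt ℂ (fun A : PBond (F.P K) 0 → Matrix (Fin 2) (Fin 2) ℂ =>
      ((emlIterU (K - n) (fun b => expCfg η (σ A) b * unitsField (toUField U₀) b) ec : (Matrix (Fin 2) (Fin 2) ℂ)ˣ) : Matrix (Fin 2) (Fin 2) ℂ) *
        (((emlIterU (K - n) (unitsField (toUField U₀)) ec)⁻¹ : (Matrix (Fin 2) (Fin 2) ℂ)ˣ) : Matrix (Fin 2) (Fin 2) ℂ)) A₀ := by
    have h1 := analyticAt_relIter_of_plaqSmall hk1 U₀ ha₀0 hU η (σ A₀) ht1 hA₀' (by rw [hd, hLL]; exact hbudget) ec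
    exact AnalyticAt.comp_of_eq h1 (σ.analyticAt A₀) rfl
  -- the factorisation, then products of analytic maps into `M₂(ℂ)`
  have hfun : (fun A : PBond (F.P K) 0 → Matrix (Fin 2) (Fin 2) ℂ => ((dbarTwS F n K h U₀ A c : (Matrix (Fin 2) (Fin 2) ℂ)ˣ) : Matrix (Fin 2) (Fin 2) ℂ))
      = fun A => (((frameTwS F n K h U₀ A c.src)⁻¹ : (Matrix (Fin 2) (Fin 2) ℂ)ˣ) : Matrix (Fin 2) (Fin 2) ℂ)
          * (((emlIterU (K - n) (fun b => expCfg η (σ A) b * unitsField (toUField U₀) b) ec : (Matrix (Fin 2) (Fin 2) ℂ)ˣ) : Matrix (Fin 2) (Fin 2) ℂ) *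
              (((emlIterU (K - n) (unitsField (toUField U₀)) ec)⁻¹ : (Matrix (Fin 2) (Fin 2) ℂ)ˣ) : Matrix (Fin 2) (Fin 2) ℂ))
          * (((descendToGL F n K h (bgUnits F K U₀) c : (Matrix (Fin 2) (Fin 2) ℂ)ˣ) : Matrix (Fin 2) (Fin 2) ℂ)
              * ((frameTwS F n K h U₀ A c.tgt : (Matrix (Fin 2) (Fin 2) ℂ)ˣ) : Matrix (Fin 2) (Fin 2) ℂ)
              * (((descendToGL F n K h (bgUnits F K U₀) c)⁻¹ : (Matrix (Fin 2) (Fin 2) ℂ)ˣ) : Matrix (Fin 2) (Fin 2) ℂ)) := by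
    funext A
    rw [dbarTwS_eq_conj, Units.val_mul, Units.val_mul, Units.val_mul, Units.val_mul, Units.val_mul, descendToGL_rel_eq_emlIterU F h hηne U₀ A c, ← hσ_apply]
  rw [hfun]
  exact ((analyticAt_units_inv (hfr c.src)).mul hmid).mul ((analyticAt_const.mul (hfr c.tgt)).mul analyticAt_const)

include hε₀ he hWe hWε hreg in
/-- The window on the ball: `‖U̿^{twS}(A)(c) − 1‖ ≤ 3(2e + 2700Lε₀) ≤ ½` for `‖A‖ < e·η` (W3 ✓p617963 at the bondwise reads `‖A(b)‖ ≤ ‖A‖`). [cite: Balaban1985Averaging, (161)–(163) p.42, p.44] -/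
theorem norm_dbarTwS_sub_one_le_of_mem_ball (c : PBond (F.P n) 0) {A : PBond (F.P K) 0 → Matrix (Fin 2) (Fin 2) ℂ} (hA : ‖A‖ < e * eta F n K) :
    ‖((dbarTwS F n K h U₀ A c : (Matrix (Fin 2) (Fin 2) ℂ)ˣ) : Matrix (Fin 2) (Fin 2) ℂ) - 1‖ ≤ 3 * (2 * e + 2700 * (F.L : ℝ) * ε₀) ∧
      ‖((dbarTwS F n K h U₀ A c : (Matrix (Fin 2) (Fin 2) ℂ)ˣ) : Matrix (Fin 2) (Fin 2) ℂ) - 1‖ ≤ 1 / 2 := by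
  have h1 := (norm_dbarTwS_sub_one_le F h hε₀ he.le hWe hWε U₀ hreg A (norm_apply_le_of_mem_ball F hA) c).1
  exact ⟨h1, h1.trans (third_budget F hε₀ he.le hWe hWε)⟩

include hε₀ he hWe hWε hreg in
/-- ★ **(AN): THE TWISTED LOG-CHART IS ANALYTIC ON THE BALL `‖A‖ < e·η`** (bondwise `log U̿^{twS}(A)(c)` with `MatrixLog.analyticAt_mlog` inside the window `‖U̿^{twS} − 1‖ ≤ ½ < 1`).
[cite: Balaban1985BackgroundPropagators, (3.13)–(3.14) p.393; Balaban1985Averaging, Prop. 4 p.38, p.42] -/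
theorem analyticOnNhd_logChartTwS :
    AnalyticOnNhd ℂ (logChartTwS F n K h U₀) (ball (0 : PBond (F.P K) 0 → Matrix (Fin 2) (Fin 2) ℂ) (e * eta F n K)) := by
  intro A₀ hA₀
  have hA₀' : ‖A₀‖ < e * eta F n K := mem_ball_zero_iff.1 hA₀
  have hfun : logChartTwS F n K h U₀ = fun A => fun c => mlog (((dbarTwS F n K h U₀ A c : (Matrix (Fin 2) (Fin 2) ℂ)ˣ) : Matrix (Fin 2) (Fin 2) ℂ)) := by
    funext A c; rfl
  rw [hfun]
  refine analyticAt_pi_iff.mpr fun c => ?_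
  have hnear : ‖((dbarTwS F n K h U₀ A₀ c : (Matrix (Fin 2) (Fin 2) ℂ)ˣ) : Matrix (Fin 2) (Fin 2) ℂ) - 1‖ < 1 :=
    (norm_dbarTwS_sub_one_le_of_mem_ball F h hε₀ he hWe hWε U₀ hreg c hA₀').2.trans_lt (by norm_num)
  exact (analyticAt_mlog hnear).comp_of_eq (analyticAt_dbarTwS_of_mem_ball F h hε₀ he hWe hWε U₀ hreg c hA₀') rfl

include hε₀ he hWe hWε hreg in
/-- ★ **(BD): THE OSCILLATION BOUND ON THE BALL** — `‖log U̿^{twS}(A) − log U̿^{twS}(0)‖ ≤ M₀ := 2(500e + 600L(3e + 18ε₀))` for `‖A‖ < e·η` (`logChartTw U₀ 0 = 0`; bondwise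
`‖log W‖ ≤ 2‖W − 1‖` on `‖W − 1‖ ≤ ½`, `MatrixLog.norm_mlog_le_two_mul`). [cite: Balaban1985Averaging, (22)–(24) p.21, (161)–(163) p.42; Balaban1985Variational, (44) p.285] -/
theorem norm_logChartTwS_le_of_mem_ball :
    ∀ A ∈ ball (0 : PBond (F.P K) 0 → Matrix (Fin 2) (Fin 2) ℂ) (e * eta F n K),
      ‖logChartTwS F n K h U₀ A - logChartTwS F n K h U₀ 0‖ ≤ 2 * (3 * (2 * e + 2700 * (F.L : ℝ) * ε₀)) := by
  intro A hA
  have hA' : ‖A‖ < e * eta F n K := mem_ball_zero_iff.1 hA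
  rw [logChartTwS_zero, sub_zero]
  have hM : 0 ≤ 2 * (3 * (2 * e + 2700 * (F.L : ℝ) * ε₀)) := by positivity
  refine (pi_norm_le_iff_of_nonneg hM).2 fun c => ?_
  obtain ⟨h1, h2⟩ := norm_dbarTwS_sub_one_le_of_mem_ball F h hε₀ he hWe hWε U₀ hreg c hA'
  show ‖mlog (((dbarTwS F n K h U₀ A c : (Matrix (Fin 2) (Fin 2) ℂ)ˣ) : Matrix (Fin 2) (Fin 2) ℂ))‖ ≤ _
  exact (norm_mlog_le_two_mul h2).trans (by linarith)

/-! ## §3 ★★★ The `Inputs` of CHART-47-T³-tw and print's Proposition 3 for the twisted chart -/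

include hε₀ he hWe hWε hreg in
/-- ★★★ **`inputs_CmapTwS` — (44)-tw ∧ (72)-tw ∧ ANALYTICITY FOR THE TWISTED REMAINDER AT A PRINTED-REGULAR BACKGROUND, k-UNIFORM IN PRINT's VARIABLE.**  For a member `(F, n, K)`, `n ≤ K`,
a background `U₀` with `RegPr F n K ε₀ U₀`, the numerals of ✓p617963 (`10⁹L²e ≤ 1`, `10¹²L³ε₀ ≤ 1`), and any linear `H` with `‖HX‖ ≤ B₀‖X‖`:
`B11Prop3Model.Inputs (CmapTwS F n K h U₀) H (40M₀∕R²) (40M₀∕R²) B₀ (R∕4)` with `R = e·η`, `M₀ = 6(2e + 2700Lε₀)` — ★w2-20520's Schwarz reduction at `Q := logChartTw U₀` ((AN) §2,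
(BD) §2), then §1's identification of the linear remainder with `CmapTw`. [cite: Balaban1985Variational, (44) p.285, (72) p.289; Balaban1985BackgroundPropagators, (3.14) p.393; Balaban1985Averaging, Prop. 4 (134)–(135) p.38] -/
theorem inputs_CmapTwS {B₀ : ℝ} {H : (PBond (F.P n) 0 → Matrix (Fin 2) (Fin 2) ℂ) →ₗ[ℂ] (PBond (F.P K) 0 → Matrix (Fin 2) (Fin 2) ℂ)} (hH : ∀ X, ‖H X‖ ≤ B₀ * ‖X‖) :
    B11Prop3Model.Inputs (CmapTwS F n K h U₀) H
      (40 * (2 * (3 * (2 * e + 2700 * (F.L : ℝ) * ε₀))) / (e * eta F n K) ^ 2)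
      (40 * (2 * (3 * (2 * e + 2700 * (F.L : ℝ) * ε₀))) / (e * eta F n K) ^ 2)
      B₀ ((e * eta F n K) / 4) := by
  have hR : 0 < e * eta F n K := mul_pos he (eta_pos F n K)
  haveI : CompleteSpace (PBond (F.P n) 0 → Matrix (Fin 2) (Fin 2) ℂ) := FiniteDimensional.complete ℂ _
  have hmain := inputs_linRemainder_of_analyticOnNhd_of_bound (hop := H) hR
    (analyticOnNhd_logChartTwS F h hε₀ he hWe hWε U₀ hreg) (norm_logChartTwS_le_of_mem_ball F h hε₀ he hWe hWε U₀ hreg) hH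
  rw [CmapTwS_eq_linRemainder]
  exact hmain

include hε₀ he hWe hWε hreg in
/-- ★★★ **CHART-47-T³-tw AT A PRINTED-REGULAR BACKGROUND — [Balaban1985Variational] PROPOSITION 3 FOR THE TWISTED SYMMETRIC CHART, AS A THEOREM**: under the data of `inputs_CmapTwS`, `B₀ ≥ 0`, and a
radius `ε` with «9C₂B₀ε < 1» and `6ε ≤ R` (`C₂ := 40M₀∕R²`, `R := e·η`): `Chart47T3twS F n K h C₂ ε U₀ H` — (49) on the `ε`-ball, the range sandwich, (55) (✓`Prop7SymAvgTw.chart47twS_of_inputs`).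
This is the supplier of the EX knit v2-tw's displayed row `h47tw` (at `e := ef L`, given its (46)-tw letter `H`). [cite: Balaban1985Variational, Prop. 3 p.289, (44)–(49) p.285, (55) p.286, (72) p.289] -/
theorem chart47twS_of_regPr {B₀ : ℝ} (hB₀ : 0 ≤ B₀) {H : (PBond (F.P n) 0 → Matrix (Fin 2) (Fin 2) ℂ) →ₗ[ℂ] (PBond (F.P K) 0 → Matrix (Fin 2) (Fin 2) ℂ)}
    (hH : ∀ X, ‖H X‖ ≤ B₀ * ‖X‖) {ε : ℝ}
    (hq : 9 * (40 * (2 * (3 * (2 * e + 2700 * (F.L : ℝ) * ε₀))) / (e * eta F n K) ^ 2) * B₀ * ε < 1) (hRε : 6 * ε ≤ e * eta F n K) :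
    Chart47T3twS F n K h (40 * (2 * (3 * (2 * e + 2700 * (F.L : ℝ) * ε₀))) / (e * eta F n K) ^ 2) ε U₀ H := by
  have hR : 0 < e * eta F n K := mul_pos he (eta_pos F n K)
  have hC₂ : 0 ≤ 40 * (2 * (3 * (2 * e + 2700 * (F.L : ℝ) * ε₀))) / (e * eta F n K) ^ 2 := by positivity
  exact chart47twS_of_inputs (inputs_CmapTwS F h hε₀ he hWe hWε U₀ hreg hH) hC₂ hB₀ hq (by linarith)

include hε₀ he hWe hWε hreg in
/-- ★★ **THE WINDOW IS INHABITED**: under the same data (no `ε`), `∃ ε > 0, Chart47T3twS F n K h C₂ ε U₀ H` — take `ε := min (R∕6) (1∕(9C₂B₀ + 1))`.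
[cite: Balaban1985Variational, Prop. 3 p.289, (57)–(62) pp.286–287] -/
theorem exists_chart47twS_of_regPr {B₀ : ℝ} (hB₀ : 0 ≤ B₀) {H : (PBond (F.P n) 0 → Matrix (Fin 2) (Fin 2) ℂ) →ₗ[ℂ] (PBond (F.P K) 0 → Matrix (Fin 2) (Fin 2) ℂ)}
    (hH : ∀ X, ‖H X‖ ≤ B₀ * ‖X‖) :
    ∃ ε : ℝ, 0 < ε ∧ Chart47T3twS F n K h (40 * (2 * (3 * (2 * e + 2700 * (F.L : ℝ) * ε₀))) / (e * eta F n K) ^ 2) ε U₀ H := by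
  set C₂ : ℝ := 40 * (2 * (3 * (2 * e + 2700 * (F.L : ℝ) * ε₀))) / (e * eta F n K) ^ 2 with hC₂def
  set R : ℝ := e * eta F n K with hRdef
  have hR : 0 < R := mul_pos he (eta_pos F n K)
  have hC₂ : 0 ≤ C₂ := by positivity
  have h9 : 0 < 9 * C₂ * B₀ + 1 := by positivity
  refine ⟨min (R / 6) (1 / (9 * C₂ * B₀ + 1)), lt_min (by positivity) (by positivity), ?_⟩
  refine chart47twS_of_regPr F h hε₀ he hWe hWε U₀ hreg hB₀ hH ?_ ?_
  · have hle : min (R / 6) (1 / (9 * C₂ * B₀ + 1)) ≤ 1 / (9 * C₂ * B₀ + 1) := min_le_right _ _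
    have hnn : 0 ≤ 9 * C₂ * B₀ := by positivity
    calc 9 * C₂ * B₀ * min (R / 6) (1 / (9 * C₂ * B₀ + 1)) ≤ 9 * C₂ * B₀ * (1 / (9 * C₂ * B₀ + 1)) := by gcongr
      _ = 9 * C₂ * B₀ / (9 * C₂ * B₀ + 1) := by ring
      _ < 1 := by rw [div_lt_one h9]; linarith
  · have hle : min (R / 6) (1 / (9 * C₂ * B₀ + 1)) ≤ R / 6 := min_le_left _ _
    linarith

end Ball

/-! ## §4 The η-honest packaging: `‖H Y‖ ≤ B·η·‖Y‖`, radius `η·ε′`, η-FREE windows (OWNER RULING g26-№9) -/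

section Eta

variable {ε₀ e : ℝ} (hε₀ : 0 < ε₀) (he : 0 < e)
  (hWe : 10 ^ 9 * (F.L : ℝ) ^ 2 * e ≤ 1) (hWε : 10 ^ 12 * (F.L : ℝ) ^ 3 * ε₀ ≤ 1)
  (U₀ : GaugeField (F.P K) 0 (Matrix.specialUnitaryGroup (Fin 2) ℂ)) (hreg : RegPr F n K ε₀ U₀)

include hε₀ he hWe hWε hreg in
/-- ★★★ **CHART-47-T³-tw WITH THE η's CANCELLED** (the member-uniform form of `chart47twS_of_regPr`; OWNER RULING g26-№9): for a right-inverse letter `H` with the HONEST bound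
`‖H Y‖ ≤ B·η·‖Y‖` (`η = L^{−(K−n)}`; e.g. `B = 2112` for M12's `H^{sym}`, `Prop7QSymCovCandidate.exists_rightInv_QSym_of_regPr`) and a UNIT-scale radius `ε′` with the η-FREE windows
«`9·(40M₀∕e²)·B·ε′ < 1`» and `6ε′ ≤ e` (`M₀ = 6(2e + 2700Lε₀)`): `Chart47T3twS F n K h (40M₀∕(e·η)²) (η·ε′) U₀ H` — Prop. 3-tw on the exponent-scale ball of radius `η·ε′` (print's
«A = ηA′» scaling, (5) p.278; the contraction constant `C₂·‖H‖·ε₃ = (40M₀∕e²)·B·ε′` is height-free, as print's `O(1)C₁B₃ε₁` of (76)).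
[cite: Balaban1985Variational, Prop. 3 p.289, (44)–(49) p.285, (55) p.286, (76) p.289, (5) p.278] -/
theorem chart47twS_of_regPr_eta {B : ℝ} (hB : 0 ≤ B) {H : (PBond (F.P n) 0 → Matrix (Fin 2) (Fin 2) ℂ) →ₗ[ℂ] (PBond (F.P K) 0 → Matrix (Fin 2) (Fin 2) ℂ)}
    (hH : ∀ X, ‖H X‖ ≤ B * eta F n K * ‖X‖) {ε' : ℝ}
    (hq : 9 * (40 * (2 * (3 * (2 * e + 2700 * (F.L : ℝ) * ε₀))) / e ^ 2) * B * ε' < 1) (hRε : 6 * ε' ≤ e) :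
    Chart47T3twS F n K h (40 * (2 * (3 * (2 * e + 2700 * (F.L : ℝ) * ε₀))) / (e * eta F n K) ^ 2) (eta F n K * ε') U₀ H := by
  have hη : 0 < eta F n K := eta_pos F n K
  set M : ℝ := 40 * (2 * (3 * (2 * e + 2700 * (F.L : ℝ) * ε₀))) with hM
  refine chart47twS_of_regPr F h hε₀ he hWe hWε U₀ hreg (B₀ := B * eta F n K) (by positivity) hH ?_ ?_
  · -- `9·(M∕(eη)²)·(Bη)·(ηε′) = 9·(M∕e²)·B·ε′`
    have hcalc : 9 * (M / (e * eta F n K) ^ 2) * (B * eta F n K) * (eta F n K * ε') = 9 * (M / e ^ 2) * B * ε' := by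
      field_simp
    rw [hcalc]; exact hq
  · nlinarith

end Eta

end Summit.QuantumFields.YangMills.Theorems.Prop7CmapTwSymInputs

end
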